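import Literature.Computability.Cryptography.LeftoverHashLemma
import Mathlib.Data.Matrix.Mul
import Mathlib.GroupTheory.Index
import Mathlib.Algebra.Group.Subgroup.Finite
import Mathlib.Analysis.SpecialFunctions.Log.Base
import Mathlib.Data.ZMod.Basic
import HarnessLib

/-!
# The Leftover Hash Lemma for universal families, and `(H, Hz) ≈ (H, u)` over `ℤ_q` (BLPRS 2013, Lemma 2.2)

Topic `Computability/Cryptography` (family `pqc`), sequel of `LeftoverHashLemma.lean`. Bottom layer
of the decomposition of Brakerski–Langlois–Peikert–Regev–Stehlé 2013
(`blprs_gapSVP_sqrt_dim_to_lwe_classical`, pqc.S21): their Lemma 2.2, the leftover-hash step of the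
binary-secret reduction (BLPRS Lemma 4.9). Everything here is PROVED; theorems only.

The tree's `LeftoverHash.leftoverHash_flat` assumes a PAIRWISE INDEPENDENT family
(`IsPairwiseIndep`); the matrix family `z ↦ Hz` on `{0,1}ⁿ` is not pairwise independent (`z = 0` is
sent to `0` by every key) but it is UNIVERSAL (`Pr_H[Hz = Hz'] = q^{-k}` for `z ≠ z'` binary), and the
printed proof (collision probability, Arora–Barak 2009, Lemma 21.26) only uses universality. Hence:

* `LeftoverHash.card_collisions_keyed_mul_le_of_universal`,
  `LeftoverHash.leftoverHash_flat_of_universal` — the flat Leftover Hash Lemma for a UNIVERSAL family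
  (`#{k : h_k x = h_k x'} · |γ| ≤ |K|` for `x ≠ x'`): `Δ((K, h_K(X)), U_{K × γ}) ≤ ½ √(|γ|/|S|)` (same
  proof as the tree's pairwise-independent version, with the one equality replaced by `≤`).
* `LeftoverHash.card_filter_mulVec_eq_mul_card` — universality of `H ↦ Hd` over `ℤ_q`: if some
  coordinate `dᵢ` satisfies `dᵢ² = 1` then `#{H : Hd = 0} · q^k = q^{kn}` (the map `H ↦ Hd` is a
  surjective additive homomorphism `ℤ_q^{k×n} → ℤ_q^k`; first isomorphism theorem / index of the
  kernel).
* `LeftoverHash.card_binVecs` — the flat source `{0,1}ⁿ ⊆ ℤ_qⁿ` (a filtered `Finset.univ`; no new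
  definition) has size `2ⁿ` for `q ≥ 2`.
* `LeftoverHash.distUnif_matrix_binVecs_le` — `Δ((H, Hz), (H, u)) ≤ ½ √(q^k / 2ⁿ)` for `H ← ℤ_q^{k×n}`,
  `z ← {0,1}ⁿ`, `u ← ℤ_q^k` (`q ≥ 2`).
* `LeftoverHash.blprs_lemma_2_2` — **BLPRS 2013, Lemma 2.2**: for `q ≥ 2`, `ε > 0` and
  `n ≥ k log₂ q + 2 log₂(1/ε)`, that distance is `≤ ε` (indeed `≤ ε/2`). (BLPRS allow `q = 1`, where
  both distributions coincide; that degenerate case is excluded here.)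

Distances are the finite sums `LeftoverHash.distUnif` of `LeftoverHashLemma.lean` (statistical
distance of `keyed h (U_{K×S})` from the uniform distribution on `K × γ`), BLPRS's `𝕋_q` being
identified with `ℤ_q = ZMod q`.

## References

* Z. Brakerski, A. Langlois, C. Peikert, O. Regev, D. Stehlé, *Classical hardness of learning with
  errors*, STOC 2013, Lemma 2.2 (arXiv:1306.0281).
* J. Håstad, R. Impagliazzo, L. A. Levin, M. Luby, *A pseudorandom generator from any one-way
  function*, SIAM J. Comput. 28 (1999) (Leftover Hash Lemma).
* S. Arora, B. Barak, *Computational Complexity: A Modern Approach*, CUP 2009, Lemma 21.26 and its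
  proof (collision probability).
-/

namespace Literature.Computability.Cryptography

open Finset

namespace LeftoverHash

/-! ### The flat Leftover Hash Lemma for universal families -/

section Universal

variable {κ α γ : Type*} [DecidableEq γ] [Fintype γ]

/-- A pairwise independent family is universal: `#{k : h_k x = h_k x'} · |γ| ≤ |K|` for `x ≠ x'`
(with equality, `IsPairwiseIndep.card_collide`). [cite: AroraBarak2009, Lemma 21.26 (proof)] -/
theorem IsPairwiseIndep.universal {K : Finset κ} {h : κ → α → γ} {S : Finset α}
    (hK : IsPairwiseIndep K h S) :
    ∀ x ∈ S, ∀ x' ∈ S, x ≠ x' → (K.filter fun k => h k x = h k x').card * Fintype.card γ ≤ K.card :=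
  fun _ hx _ hx' hne => (hK.card_collide hx hx' hne).le

/-- **Collision count of the keyed hash of a flat source, universal family**: if
`#{k : h_k x = h_k x'} · |γ| ≤ |K|` for all `x ≠ x'` in `S`, then
`#{((k,x),(k',x')) : (k, h_k x) = (k', h_{k'} x')} · |γ| ≤ |K| · |S| · (|γ| + |S|)`. Same proof as the
tree's `card_collisions_keyed_mul_le` (Arora–Barak 2009, proof of Lemma 21.26), whose only use of
pairwise independence is this collision bound. [cite: AroraBarak2009, Lemma 21.26 (proof)] -/
theorem card_collisions_keyed_mul_le_of_universal [DecidableEq κ] {K : Finset κ} {h : κ → α → γ}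
    {S : Finset α} [DecidableEq α]
    (hU : ∀ x ∈ S, ∀ x' ∈ S, x ≠ x' → (K.filter fun k => h k x = h k x').card * Fintype.card γ ≤ K.card) :
    (((K ×ˢ S) ×ˢ (K ×ˢ S)).filter fun p => keyed h p.1 = keyed h p.2).card * Fintype.card γ ≤
      K.card * S.card * (Fintype.card γ + S.card) := by
  classical
  -- split the colliding pairs according to `x = x'` or not
  set C := ((K ×ˢ S) ×ˢ (K ×ˢ S)).filter fun p => keyed h p.1 = keyed h p.2 with hC
  set Cdiag := C.filter fun p => p.1.2 = p.2.2 with hCd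
  set Coff := C.filter fun p => p.1.2 ≠ p.2.2 with hCo
  have hsplit : C.card = Cdiag.card + Coff.card := by
    rw [hCd, hCo, ← Finset.card_filter_add_card_filter_not (p := fun p : (κ × α) × (κ × α) => p.1.2 = p.2.2)]
  -- diagonal: at most `|K| |S|` (determined by `(k, x)`)
  have hdiag : Cdiag.card ≤ K.card * S.card := by
    have hinj : Set.InjOn (fun p : (κ × α) × (κ × α) => p.1) Cdiag := by
      intro p hp q hq heq
      have hp' := Finset.mem_filter.1 hp
      have hq' := Finset.mem_filter.1 hq
      have hk := congrArg Prod.fst (Finset.mem_filter.1 hp'.1).2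
      have hl := congrArg Prod.fst (Finset.mem_filter.1 hq'.1).2
      dsimp only [keyed] at hk hl
      rcases p with ⟨⟨k, x⟩, ⟨k', x'⟩⟩
      rcases q with ⟨⟨l, y⟩, ⟨l', y'⟩⟩
      simp only [Prod.mk.injEq] at heq hk hl hp' hq' ⊢
      obtain ⟨rfl, rfl⟩ := heq
      exact ⟨⟨rfl, rfl⟩, hk.symm.trans hl, hp'.2.symm.trans hq'.2⟩
    have hsub : Cdiag.image (fun p : (κ × α) × (κ × α) => p.1) ⊆ K ×ˢ S := by
      intro q hq
      obtain ⟨p, hp, rfl⟩ := Finset.mem_image.1 hq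
      exact (Finset.mem_product.1 (Finset.mem_filter.1 (Finset.mem_filter.1 hp).1).1).1
    calc Cdiag.card = (Cdiag.image fun p => p.1).card := (Finset.card_image_of_injOn hinj).symm
      _ ≤ (K ×ˢ S).card := Finset.card_le_card hsub
      _ = K.card * S.card := Finset.card_product _ _
  -- off-diagonal: inject into triples `(k, x, x')` with `x ≠ x'`, `h_k x = h_k x'`, and count those
  -- fibrewise over `(x, x')`: at most `|K|/|γ|` keys each, by universality
  have hoff : Coff.card * Fintype.card γ ≤ K.card * S.card * S.card := by
    set OD := (S ×ˢ S).filter fun q : α × α => q.1 ≠ q.2 with hOD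
    set Z : Finset (κ × (α × α)) := (K ×ˢ OD).filter fun t => h t.1 t.2.1 = h t.1 t.2.2 with hZ
    have hinj : Set.InjOn (fun p : (κ × α) × (κ × α) => (p.1.1, (p.1.2, p.2.2))) Coff := by
      intro p hp q hq heq
      have hk := congrArg Prod.fst (Finset.mem_filter.1 (Finset.mem_filter.1 hp).1).2
      have hl := congrArg Prod.fst (Finset.mem_filter.1 (Finset.mem_filter.1 hq).1).2
      dsimp only [keyed] at hk hl
      rcases p with ⟨⟨k, x⟩, ⟨k', x'⟩⟩
      rcases q with ⟨⟨l, y⟩, ⟨l', y'⟩⟩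
      simp only [Prod.mk.injEq] at heq hk hl ⊢
      obtain ⟨rfl, rfl, rfl⟩ := heq
      exact ⟨⟨rfl, rfl⟩, hk.symm.trans hl, rfl⟩
    have himg : Coff.image (fun p : (κ × α) × (κ × α) => (p.1.1, (p.1.2, p.2.2))) ⊆ Z := by
      intro t ht
      obtain ⟨p, hp, rfl⟩ := Finset.mem_image.1 ht
      have hp1 := Finset.mem_filter.1 hp
      have hp2 := Finset.mem_filter.1 hp1.1
      have hmem := Finset.mem_product.1 hp2.1
      have hk := congrArg Prod.fst hp2.2
      have hh := congrArg Prod.snd hp2.2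
      dsimp only [keyed] at hk hh
      refine Finset.mem_filter.2 ⟨Finset.mem_product.2 ⟨(Finset.mem_product.1 hmem.1).1, ?_⟩, ?_⟩
      · exact Finset.mem_filter.2 ⟨Finset.mem_product.2 ⟨(Finset.mem_product.1 hmem.1).2, (Finset.mem_product.1 hmem.2).2⟩, hp1.2⟩
      · show h p.1.1 p.1.2 = h p.1.1 p.2.2
        rw [hh, hk]
    have hfib : ∀ q ∈ OD, (Z.filter fun t => t.2 = q).card = (K.filter fun k => h k q.1 = h k q.2).card := by
      intro q hq
      rw [← Finset.card_image_of_injective (K.filter fun k => h k q.1 = h k q.2)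
        (f := fun k : κ => (k, q)) (fun a b hab => (Prod.mk.inj hab).1)]
      congr 1
      ext ⟨k, q'⟩
      simp only [hZ, Finset.mem_filter, Finset.mem_product, Finset.mem_image, Prod.mk.injEq]
      constructor
      · rintro ⟨⟨⟨hk, _⟩, hh⟩, rfl⟩
        exact ⟨k, ⟨hk, hh⟩, rfl, rfl⟩
      · rintro ⟨k₀, ⟨hk₀, hh⟩, rfl, rfl⟩
        exact ⟨⟨⟨hk₀, hq⟩, hh⟩, rfl⟩
    have hZcount : Z.card = ∑ q ∈ OD, (K.filter fun k => h k q.1 = h k q.2).card := by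
      rw [Finset.card_eq_sum_card_fiberwise (f := fun t : κ × (α × α) => t.2) (t := OD)
        (fun t ht => (Finset.mem_product.1 (Finset.mem_filter.1 ht).1).2)]
      exact Finset.sum_congr rfl hfib
    have hZ' : Z.card * Fintype.card γ ≤ K.card * S.card * S.card := by
      calc Z.card * Fintype.card γ = ∑ q ∈ OD, (K.filter fun k => h k q.1 = h k q.2).card * Fintype.card γ := by
            rw [hZcount, Finset.sum_mul]
        _ ≤ ∑ _q ∈ OD, K.card := by
            refine Finset.sum_le_sum fun q hq => ?_
            have hq' := Finset.mem_filter.1 hq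
            have hqS := Finset.mem_product.1 hq'.1
            exact hU _ hqS.1 _ hqS.2 hq'.2
        _ ≤ ∑ _q ∈ S ×ˢ S, K.card := Finset.sum_le_sum_of_subset_of_nonneg (Finset.filter_subset _ _) fun _ _ _ => Nat.zero_le _
        _ = K.card * S.card * S.card := by rw [Finset.sum_const, Finset.card_product, smul_eq_mul]; ring
    have hle : Coff.card ≤ Z.card :=
      (Finset.card_image_of_injOn hinj).symm.le.trans (Finset.card_le_card himg)
    exact (Nat.mul_le_mul_right _ hle).trans hZ'
  calc C.card * Fintype.card γ = Cdiag.card * Fintype.card γ + Coff.card * Fintype.card γ := by rw [hsplit, add_mul]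
    _ ≤ K.card * S.card * Fintype.card γ + K.card * S.card * S.card := add_le_add (Nat.mul_le_mul_right _ hdiag) hoff
    _ = K.card * S.card * (Fintype.card γ + S.card) := by ring

/-- **Leftover Hash Lemma, flat sources, universal family** (Håstad–Impagliazzo–Levin–Luby 1999;
Arora–Barak 2009, Lemma 21.26, whose collision-probability proof needs only universality): for a
universal family `(h_k)_{k ∈ K}` into a finite set `γ` and `X` uniform on `S ≠ ∅`,
`Δ((K, h_K(X)), U_{K × γ}) ≤ ½ √(|γ| / |S|)`. [cite: AroraBarak2009, Lemma 21.26] -/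
theorem leftoverHash_flat_of_universal [DecidableEq κ] {K : Finset κ} (hKne : K.Nonempty)
    {h : κ → α → γ} {S : Finset α} [DecidableEq α] [Nonempty γ] (hS : S.Nonempty)
    (hU : ∀ x ∈ S, ∀ x' ∈ S, x ≠ x' → (K.filter fun k => h k x = h k x').card * Fintype.card γ ≤ K.card) :
    distUnif (K ×ˢ S) (keyed h) (K ×ˢ (Finset.univ : Finset γ)) ≤
      2⁻¹ * Real.sqrt (Fintype.card γ / S.card) := by
  classical
  have hKc : (0 : ℝ) < K.card := by exact_mod_cast hKne.card_pos
  have hSc : (0 : ℝ) < S.card := by exact_mod_cast hS.card_pos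
  have hγ : (0 : ℝ) < Fintype.card γ := by exact_mod_cast Fintype.card_pos
  have hmaps : ∀ p ∈ K ×ˢ S, keyed h p ∈ K ×ˢ (Finset.univ : Finset γ) := fun p hp =>
    Finset.mem_product.2 ⟨(Finset.mem_product.1 hp).1, Finset.mem_univ _⟩
  have hTne : (K ×ˢ (Finset.univ : Finset γ)).Nonempty := hKne.product Finset.univ_nonempty
  refine (distUnif_le_sqrt (hKne.product hS) hTne hmaps).trans ?_
  refine mul_le_mul_of_nonneg_left (Real.sqrt_le_sqrt ?_) (by norm_num)
  -- `|T| · CP − 1 ≤ |γ|/|S|`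
  have hcoll := card_collisions_keyed_mul_le_of_universal hU
  have hcollR : ((((K ×ˢ S) ×ˢ (K ×ˢ S)).filter fun p => keyed h p.1 = keyed h p.2).card : ℝ) * Fintype.card γ ≤
      K.card * S.card * (Fintype.card γ + S.card) := by exact_mod_cast hcoll
  unfold collProb
  rw [Finset.card_product, Finset.card_product, Finset.card_univ, Nat.cast_mul, Nat.cast_mul]
  rw [sub_le_iff_le_add]
  have hKS : (0 : ℝ) < (K.card : ℝ) * S.card := mul_pos hKc hSc
  rw [show ((K.card : ℝ) * (Fintype.card γ : ℝ)) * ((((K ×ˢ S) ×ˢ (K ×ˢ S)).filter fun p => keyed h p.1 = keyed h p.2).card / ((K.card : ℝ) * S.card) ^ 2)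
      = ((((K ×ˢ S) ×ˢ (K ×ˢ S)).filter fun p => keyed h p.1 = keyed h p.2).card * Fintype.card γ) / (K.card * S.card * S.card) by
    field_simp]
  rw [div_le_iff₀ (by positivity)]
  calc ((((K ×ˢ S) ×ˢ (K ×ˢ S)).filter fun p => keyed h p.1 = keyed h p.2).card : ℝ) * Fintype.card γ
      ≤ K.card * S.card * (Fintype.card γ + S.card) := hcollR
    _ = (Fintype.card γ / S.card + 1) * (K.card * S.card * S.card) := by field_simp

end Universal

/-! ### The matrix family `z ↦ Hz` over `ℤ_q` -/

section MatrixFamily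

variable {q : ℕ} [NeZero q] {k n : ℕ}

/-- **Universality of the matrix family**: if the vector `d ∈ ℤ_qⁿ` has a coordinate `dᵢ` with
`dᵢ · dᵢ = 1` (e.g. `dᵢ = ±1`, as for the difference of two distinct binary vectors), then exactly
`q^{kn}/q^k` matrices `H ∈ ℤ_q^{k×n}` satisfy `H d = 0`:
`#{H : Hd = 0} · |ℤ_q^k| = |ℤ_q^{k×n}|`. Proof: `H ↦ Hd` is an additive homomorphism onto `ℤ_q^k`
(the matrix with `i`-th column `dᵢ v` and zeros elsewhere maps to `v`), so its kernel has index
`|ℤ_q^k|`. [folklore] -/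
theorem card_filter_mulVec_eq_mul_card (d : Fin n → ZMod q) {i : Fin n} (hi : d i * d i = 1) :
    (Finset.univ.filter fun H : Matrix (Fin k) (Fin n) (ZMod q) => H.mulVec d = 0).card *
        Fintype.card (Fin k → ZMod q) =
      Fintype.card (Matrix (Fin k) (Fin n) (ZMod q)) := by
  classical
  -- the homomorphism `Φ H = H d`
  let Φ : Matrix (Fin k) (Fin n) (ZMod q) →+ (Fin k → ZMod q) :=
    { toFun := fun H => H.mulVec d
      map_zero' := Matrix.zero_mulVec d
      map_add' := fun A B => Matrix.add_mulVec A B d }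
  -- surjectivity: the matrix with `i`-th column `dᵢ v`
  have hsurj : Function.Surjective Φ := by
    intro v
    refine ⟨Matrix.of fun a b => if b = i then d i * v a else 0, ?_⟩
    funext a
    show (Matrix.of fun a b => if b = i then d i * v a else 0).mulVec d a = v a
    rw [Matrix.mulVec, dotProduct]
    simp only [Matrix.of_apply, ite_mul, zero_mul, Finset.sum_ite_eq', Finset.mem_univ, if_true]
    rw [mul_comm (d i) (v a), mul_assoc, hi, mul_one]
  -- the kernel as a filtered `univ`
  have hker : Nat.card Φ.ker =
      (Finset.univ.filter fun H : Matrix (Fin k) (Fin n) (ZMod q) => H.mulVec d = 0).card := by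
    rw [Nat.card_eq_fintype_card, ← Fintype.card_coe]
    refine Fintype.card_congr (Equiv.subtypeEquiv (Equiv.refl _) fun H => ?_)
    simp only [Equiv.refl_apply, Finset.mem_filter, Finset.mem_univ, true_and]
    exact AddMonoidHom.mem_ker
  -- index of the kernel
  have hrange : Φ.range = ⊤ := AddMonoidHom.range_eq_top_of_surjective Φ hsurj
  have hindex : Φ.ker.index = Nat.card (Fin k → ZMod q) := by
    rw [AddSubgroup.index_ker, hrange, AddSubgroup.card_top]
  have hmul := AddSubgroup.card_mul_index Φ.ker
  rw [hindex, hker, Nat.card_eq_fintype_card (α := Fin k → ZMod q),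
    Nat.card_eq_fintype_card (α := Matrix (Fin k) (Fin n) (ZMod q))] at hmul
  exact hmul

/-- `0 ∈ {0,1}ⁿ`, so the flat source `{0,1}ⁿ ⊆ ℤ_qⁿ` (vectors with every coordinate `0` or `1`,
written as a filtered `Finset.univ` throughout, to keep this file free of new definitions; membership
is `Finset.mem_filter_univ`) is nonempty. [folklore] -/
theorem binVecs_nonempty :
    (Finset.univ.filter fun z : Fin n → ZMod q => ∀ j, z j = 0 ∨ z j = 1).Nonempty :=
  ⟨0, (mem_filter_univ 0).2 fun _ => Or.inl rfl⟩

/-- For `q ≥ 2` the flat source `{0,1}ⁿ ⊆ ℤ_qⁿ` has exactly `2ⁿ` elements (it is the image of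
`{0,1}ⁿ = (Fin n → Bool)` under the injective map `b ↦ (bⱼ ? 1 : 0)`, injective since `0 ≠ 1` in
`ℤ_q`). [folklore] -/
theorem card_binVecs (hq : 1 < q) :
    (Finset.univ.filter fun z : Fin n → ZMod q => ∀ j, z j = 0 ∨ z j = 1).card = 2 ^ n := by
  classical
  haveI : Fact (1 < q) := ⟨hq⟩
  have h01 : (0 : ZMod q) ≠ 1 := zero_ne_one
  set e : (Fin n → Bool) → (Fin n → ZMod q) := fun b j => if b j then 1 else 0 with he
  have hinj : Function.Injective e := by
    intro b b' hbb'
    funext j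
    have := congrFun hbb' j
    simp only [he] at this
    cases hb : b j <;> cases hb' : b' j <;> simp_all
  have himg : Finset.univ.image e = (Finset.univ.filter fun z : Fin n → ZMod q => ∀ j, z j = 0 ∨ z j = 1) := by
    ext z
    simp only [Finset.mem_image, Finset.mem_univ, true_and, mem_filter_univ]
    constructor
    · rintro ⟨b, rfl⟩ j
      simp only [he]
      cases b j <;> simp
    · intro hz
      refine ⟨fun j => decide (z j = 1), funext fun j => ?_⟩
      rcases hz j with h | h
      · simp [he, h, h01]
      · simp [he, h]
  rw [← himg, Finset.card_image_of_injective _ hinj, Finset.card_univ, Fintype.card_fun,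
    Fintype.card_bool, Fintype.card_fin]

/-- Two distinct binary vectors differ in a coordinate where the difference is `±1`, hence squares
to `1`. [folklore] -/
theorem exists_sub_mul_sub_eq_one {z z' : Fin n → ZMod q}
    (hz : z ∈ (Finset.univ.filter fun z : Fin n → ZMod q => ∀ j, z j = 0 ∨ z j = 1))
    (hz' : z' ∈ (Finset.univ.filter fun z : Fin n → ZMod q => ∀ j, z j = 0 ∨ z j = 1))
    (hne : z ≠ z') : ∃ i, (z - z') i * (z - z') i = 1 := by
  obtain ⟨i, hi⟩ : ∃ i, z i ≠ z' i := by
    by_contra hcon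
    push Not at hcon
    exact hne (funext hcon)
  refine ⟨i, ?_⟩
  simp only [Pi.sub_apply]
  rcases (mem_filter_univ z).1 hz i with h0 | h1 <;> rcases (mem_filter_univ z').1 hz' i with h0' | h1'
  · exact absurd (h0.trans h0'.symm) hi
  · rw [h0, h1']; ring
  · rw [h1, h0']; ring
  · exact absurd (h1.trans h1'.symm) hi

/-- **`(H, Hz)` is close to `(H, u)`** (the Leftover Hash Lemma for the universal matrix family):
for `q ≥ 2`, `H ← ℤ_q^{k×n}` uniform, `z ← {0,1}ⁿ` uniform and `u ← ℤ_q^k` uniform,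
`Δ((H, Hz), (H, u)) ≤ ½ √(q^k / 2ⁿ)`. [cite: BrakerskiEtAl2013, Lemma 2.2 (proof: leftover hash lemma)] -/
theorem distUnif_matrix_binVecs_le (hq : 1 < q) :
    distUnif ((Finset.univ : Finset (Matrix (Fin k) (Fin n) (ZMod q))) ×ˢ
          (Finset.univ.filter fun z : Fin n → ZMod q => ∀ j, z j = 0 ∨ z j = 1))
        (keyed fun (H : Matrix (Fin k) (Fin n) (ZMod q)) (z : Fin n → ZMod q) => H.mulVec z)
        (Finset.univ ×ˢ (Finset.univ : Finset (Fin k → ZMod q))) ≤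
      2⁻¹ * Real.sqrt ((q : ℝ) ^ k / 2 ^ n) := by
  classical
  have hU : ∀ z ∈ (Finset.univ.filter fun z : Fin n → ZMod q => ∀ j, z j = 0 ∨ z j = 1),
      ∀ z' ∈ (Finset.univ.filter fun z : Fin n → ZMod q => ∀ j, z j = 0 ∨ z j = 1), z ≠ z' →
      ((Finset.univ : Finset (Matrix (Fin k) (Fin n) (ZMod q))).filter
          fun H => H.mulVec z = H.mulVec z').card * Fintype.card (Fin k → ZMod q) ≤
        (Finset.univ : Finset (Matrix (Fin k) (Fin n) (ZMod q))).card := by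
    intro z hz z' hz' hne
    obtain ⟨i, hi⟩ := exists_sub_mul_sub_eq_one hz hz' hne
    have hset : ((Finset.univ : Finset (Matrix (Fin k) (Fin n) (ZMod q))).filter
        fun H => H.mulVec z = H.mulVec z') =
        Finset.univ.filter fun H : Matrix (Fin k) (Fin n) (ZMod q) => H.mulVec (z - z') = 0 := by
      refine Finset.filter_congr fun H _ => ?_
      rw [Matrix.mulVec_sub, sub_eq_zero]
    rw [hset, card_filter_mulVec_eq_mul_card (z - z') hi, Finset.card_univ]
  have h := leftoverHash_flat_of_universal (Finset.univ_nonempty) binVecs_nonempty hU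
  rw [card_binVecs hq] at h
  convert h using 3
  rw [Fintype.card_fun, ZMod.card, Fintype.card_fin]
  push_cast
  ring

/-- **BLPRS 2013, Lemma 2.2** (immediate corollary of the leftover hash lemma): let `k, n ≥ 0`,
`q ≥ 2` be integers and `ε > 0` with `n ≥ k log₂ q + 2 log₂(1/ε)`. For `H ← 𝕋_q^{k×n} = ℤ_q^{k×n}`,
`z ← {0,1}ⁿ`, `u ← ℤ_q^k` (uniform, independent), the distributions of `(H, Hz)` and `(H, u)` are
within statistical distance `ε` (indeed `ε/2`; the distance is `LeftoverHash.distUnif` of the keyed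
map `(H, z) ↦ (H, Hz)` on the flat source `ℤ_q^{k×n} × {0,1}ⁿ` from uniform on `ℤ_q^{k×n} × ℤ_q^k`).
BLPRS state it for `q ≥ 1`; for `q = 1` both distributions are the same point mass and there is
nothing to prove, so only `q ≥ 2` is treated. [cite: BrakerskiEtAl2013, Lemma 2.2] -/
theorem blprs_lemma_2_2 (hq : 1 < q) {ε : ℝ} (hε : 0 < ε)
    (hn : (k : ℝ) * Real.logb 2 q + 2 * Real.logb 2 (1 / ε) ≤ n) :
    distUnif ((Finset.univ : Finset (Matrix (Fin k) (Fin n) (ZMod q))) ×ˢ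
          (Finset.univ.filter fun z : Fin n → ZMod q => ∀ j, z j = 0 ∨ z j = 1))
        (keyed fun (H : Matrix (Fin k) (Fin n) (ZMod q)) (z : Fin n → ZMod q) => H.mulVec z)
        (Finset.univ ×ˢ (Finset.univ : Finset (Fin k → ZMod q))) ≤ ε := by
  refine (distUnif_matrix_binVecs_le hq).trans ?_
  have hq0 : (0 : ℝ) < q := by exact_mod_cast (zero_lt_one.trans hq)
  have h2 : (1 : ℝ) < 2 := by norm_num
  -- `q^k / ε² ≤ 2^n`
  have hpow : (q : ℝ) ^ k / ε ^ 2 ≤ (2 : ℝ) ^ n := by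
    have h1 : (2 : ℝ) ^ ((k : ℝ) * Real.logb 2 q + 2 * Real.logb 2 (1 / ε)) ≤ (2 : ℝ) ^ (n : ℝ) :=
      Real.rpow_le_rpow_of_exponent_le h2.le hn
    rw [Real.rpow_natCast] at h1
    have hA : (2 : ℝ) ^ ((k : ℝ) * Real.logb 2 q) = (q : ℝ) ^ k := by
      rw [mul_comm, Real.rpow_mul (by norm_num), Real.rpow_logb (by norm_num) (by norm_num) hq0,
        Real.rpow_natCast]
    have hB : (2 : ℝ) ^ (2 * Real.logb 2 (1 / ε)) = (1 / ε) ^ 2 := by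
      rw [mul_comm, Real.rpow_mul (by norm_num),
        Real.rpow_logb (by norm_num) (by norm_num) (by positivity), Real.rpow_two]
    have h3 : (2 : ℝ) ^ ((k : ℝ) * Real.logb 2 q + 2 * Real.logb 2 (1 / ε)) = (q : ℝ) ^ k / ε ^ 2 := by
      rw [Real.rpow_add (by norm_num), hA, hB]
      field_simp
    rwa [h3] at h1
  have hratio : (q : ℝ) ^ k / 2 ^ n ≤ ε ^ 2 := by
    have h2n : (0 : ℝ) < 2 ^ n := by positivity
    rw [div_le_iff₀ h2n]
    rw [div_le_iff₀ (by positivity)] at hpow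
    linarith
  have hsqrt : Real.sqrt ((q : ℝ) ^ k / 2 ^ n) ≤ ε := by
    rw [Real.sqrt_le_left hε.le]
    exact hratio
  linarith [Real.sqrt_nonneg ((q : ℝ) ^ k / 2 ^ n)]

end MatrixFamily

end LeftoverHash

end Literature.Computability.Cryptography
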